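import Literature.MathematicalPhysics.QuantumFieldTheory.Balaban1983to89.B6MultiLevelBoxOperatorL0
import Literature.MathematicalPhysics.QuantumFieldTheory.Balaban1983to89.B6Eq238MultiLevelBox

/-!
# `Balaban1983to89.B6Eq238MultiLevelBoxL0` — [B6] (2.36)–(2.38) FOR THE GENUINE `k`-LEVEL OPERATOR `Δ′_a` ON A BOX,
LEVEL `0` ADMITTED: the MULTI-SIZE cube cover `𝒟 = ⋃_{j=0}^{k} 𝒟_j` (cubes of side `2ML^jη` over `B^j(Λ_j)`, `Λ₀ = X ∖ Ω₁`
possibly non-empty), the localisation [3] (2.6) — every cube operator is LITERALLY a two-level cube operator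
`B6Ineq243TwoLevelBox.twoLevelOp` at the cube's finer scale, mesh exponent `i ≥ 0` —, `G′₀ = Σ_□ h_□G′(□)h̄_□` (2.37) and
`Δ′_aG′₀ = I − Σ_□ K(h_□)G′(□)h̄_□ = I − R` (2.38) (file F4-box of the level-0 programme G-F3′-L0 = the twin of
`B6Eq238MultiLevelBox` over the structure `B6MultiLevelBoxOperatorL0.Domains`, SAME declaration names; no existing module is
touched; no fact is minted)

FRAMING (verbatim cell line):
statement-level skeleton of published theorems with citation tags; proofs where landed; nothing here is a claim about the Yang–Mills mass gap

Source under audit (cell lit-balaban): T. Bałaban, *Propagators and renormalization transformations for lattice gauge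
theories. II*, Commun. Math. Phys. **96** (1984) 223–250 [`Balaban1984PropagatorsII`, "B6"], p. 229 [PDF 7] (2.36)–(2.39),
p. 230 [PDF 8] (2.40)–(2.44); T. Bałaban, *Regularity and decay of lattice Green's functions*, Commun. Math. Phys. **89** (1983)
571–597 [`Balaban1983RegularityDecay`, "[3]"], §2 p. 575–576 ((2.2), (2.6)).  Unit `lit-balaban-p21` (Phase-2 proof seat p21
gen 26, packet S-B owner of row G-F3′-L0; plan of record `lit-balaban-r03/G-F3L0-PLAN.md` v1.0 §1/§4/§5), HOME
`run/shared/lean/pub/lit-balaban/`, B6 fold owner r03, referee ref-4.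

## WHAT IS PRINTED (p. 229–230, verbatim up to notation)

«We cover B^j(Λ_j) by a sum of cubes □ of the size 2ML^jη, each cube being a sum of 2^d big blocks with a center
y ∈ Λ_j (more exactly it belongs to the boundary of this set also). Taking these covers for all j from 0 to k we get a
family 𝒟 of cubes □ of different sizes and such that T_η = ⋃_{□∈𝒟} □. … They satisfy Σ_{□∈𝒟} h_□² = 1. (2.36) … We define
G′₀ = Σ_□ h_□G′(□)h_□, (2.37) … Δ′_aG′₀ = I − Σ_□ K(h_□)G′(□)h_□ = I − R, (2.38)» … p. 230: «Let us assume that □ is a cube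
connected with a L^jη-scale … and intersecting maybe the domain B^{j+1}(Λ_{j+1}). Rescaling all the expressions in
K(h_□)G′(□)h_□λ to L^{−j}-scale, we get (2.40) … or the last term above is replaced by a term defined in the same way but with
j + 1 instead of j and with the additional factor L^{−2} if x ∈ B^{j+1}(Λ_{j+1})».  [3] (2.6): «(−Δ^{η,N}_{A,Ω})h_jG(□_j, A_j) =
(−Δ^{η,N}_{A_j,□_j})h_jG(□_j, A_j), because the function h_j can be ≠ 0 only on the part of the boundary of □_j which is
contained in the boundary of Ω.»

## WHY THIS FILE (G-F3′-L0)

Print takes the covers «for all j from 0 to k»; the twin `B6Eq238MultiLevelBox` runs over the structure with `1 ≤ lev`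
(`Λ₀ = ∅`, levels `1 … k`).  This file re-instantiates it over `B6MultiLevelBoxOperatorL0.Domains` (`Λ₀ = X ∖ Ω₁` admitted,
F1 p533995): the level-`0` cubes have side `2M` fine sites (`bigSide ℓ M_h 0 = M_h·L`), mesh exponent `i = 0`, and their
cube operator is the mesh-one member `twoLevelOp 1 ℓ a₀ c₀ 0 …` of the two-level lane (`Q₀ = id`, the lattice-scale
mass `a₀` on the `Λ₀`-sites, «the additional factor L^{−2}» term `aNext ℓ a₀ c₀ = a₁` on the `Λ₁`-blocks of the cube).
Every `D`-free declaration of the twin (`MhP`, `Pj`, `Np_eq`, `halfWidth_eq`, `corner`, `InCube`, `uFun`,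
`inCube_iff_exists_emb`, `supNorm_lt_of_inCube`, `uFun_eq_hΩ`, `castP`, `uX`, `term_algebra`, …) is used BY NAME.

## WHAT THIS FILE CERTIFIES (kernel-checked; setting of `B6MultiLevelBoxOperatorL0`)

For a nested family `D : B6MultiLevelBoxOperatorL0.Domains d ℓ M_h k P R` (levels `0 … k` on the fine box
`X = Π[0, L^k·L·M_h·P_μ)`), weights `a_j > 0` with `a_{i+1} = aNext ℓ a_i c_i` for ALL `i ≥ 0`, and the `k`-level operator
`E = mlOp` (F1/`B6MultiLevelBoxOperator`):
* §0 **THE SUPPORT OF THE PRINTED CUT-OFF `h_□` AT EVERY MESH** (`exists_emb_eq_of_hΩ_ne_zero'`, `hLoc_eq_zero_of_IL'`,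
  `hΩ_support'`): the twin's `B6Eq238TwoLevelBox` lemmas with their hypothesis `1 ≤ k` (used there only through
  `N = L^k·L·M_h ≥ 4`) replaced by `4 ≤ L^k·L·M_h` — so that the mesh-one cubes (`k = 0`, `M = L·M_h ≥ 4`) are covered;
* §2 the level-`(i+1)` part `Λ` of the presentation (`LamG`, `isBlockUnion_LamG`);
* §3 **LOCALISATION = [3] (2.6)** (`mlOp_emb_emb`, `mlOp_emb_off`, `row_eq_pad_row`, `diagonal_mul_eq_pad`), `i ≥ 0`;
* §4 **ONE TERM OF (2.38)** (`mlOp_mul_term`) for `M_h ≥ 2` (so that `L^i·M ≥ 4` at every `i ≥ 0`);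
* §5 **THE CUBES OF THE COVER** (`Active`, `Down`, `fin`, `window_of_active`, `fin_spec`): finer level `fin ∈ {j − 1, j}`,
  now `≥ 0` (a level-`1` cube meeting `Λ₀` has `fin = 0`; a level-`0` cube has `fin = 0`);
* §6 **(2.36)–(2.38)**: the cover `𝒟` over the levels `0 ≤ j ≤ k` (`cubeSet`, `CubeData`, `fin_data`), `vFun`/`vX`, `gX`,
  `aX`, `bX`, `gZeroML = G′₀`, `rML = R`, `mlOp_mul_aX`, `sum_uv_eq_one` and **(2.38) `Δ′_a·G′₀ = 1 − R`**
  (`eq238_multiLevelBox`).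
Positional convention (plan §4, for the sed-level port of the 114-module cone): `CubeData.hj : 0 ≤ cq.1 ∧ cq.1 ≤ k` and
`fin_data hc : 0 ≤ fin ∧ fin ≤ cq.1 ∧ …` keep the conjunct POSITIONS of the twin (first conjuncts vacuous).

## HONEST SCOPE (additions to the twin's)

* As the twin: asymmetric partition `u_□ = h_□`, `v_□ = h_□·1_{B^j(Λ_j)}`; `m² = 0`; Neumann cube propagators; `R ≥ 2L`;
  here `M_h ≥ 2` (twin: `M_h ≥ 1`) so that the profile radius `⅝·M·L^i` clears the internal layer at `i = 0` too.
* The level-`0` weight `a₀` and parameter `c₀` are free positive numbers tied by `a₁ = aNext ℓ a₀ c₀` (solvable iff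
  `a₀ > a₁L^{−2}`; print's (2.19) «a_j replaced simply by a» has `c_j = aL²/(L² − 1)` for all `j`).
* Nothing is inferred from the manuscript: every step is kernel-checked; the quoted sentences locate the statement.  Value =
  the layer-1 box twin of the level-0 port; NOT summit progress.
-/

namespace Literature.MathematicalPhysics.QuantumFieldTheory.Balaban1983to89.B6Eq238MultiLevelBoxL0

open Finset Matrix
open Literature.MathematicalPhysics.QuantumFieldTheory.Balaban1983to89.B4ContourShift (supNorm abs_le_supNorm
  supNorm_nonneg)
open Literature.MathematicalPhysics.QuantumFieldTheory.Balaban1983to89.B4Reflection242 (boxDom mem_boxDom nbrs mem_nbrs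
  blk blk_mem_boxDom neumannLapK diagK avgK)
open Literature.MathematicalPhysics.QuantumFieldTheory.Balaban1983to89.B4Green242Bridge (boxNbrs)
open Literature.MathematicalPhysics.QuantumFieldTheory.Balaban1983to89.B4BoxCov237 (boxOpR)
open Literature.MathematicalPhysics.QuantumFieldTheory.Balaban1983to89.B4Lemma22ReduceZero (Box)
open Literature.MathematicalPhysics.QuantumFieldTheory.Balaban1983to89.B4SubBoxCarrier
open Literature.MathematicalPhysics.QuantumFieldTheory.Balaban1983to89.B4TwoBox120 (blk_add_mul)
open Literature.MathematicalPhysics.QuantumFieldTheory.Balaban1983to89.B4Thm110ZeroBox (boxCast boxCast_apply_val boxCast_symm_apply_val blk_blk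
  mem_boxDom_of_eq)
open Literature.MathematicalPhysics.QuantumFieldTheory.Balaban1983to89.B6Ineq243TwoLevelBox
open Literature.MathematicalPhysics.QuantumFieldTheory.Balaban1983to89.B6Partition236TwoLevelBox
open Literature.MathematicalPhysics.QuantumFieldTheory.Balaban1983to89.B6Eq238TwoLevelBox
open Literature.MathematicalPhysics.QuantumFieldTheory.Balaban1983to89.B6MultiLevelBoxOperator (N0 bigSide bigSide_eq
  bigSide_succ_eq bigSide_succ one_le_bigSide levC levC_pos indLev mlOp gml mlOp_isSymm mlOp_eq_reindex)
open Literature.MathematicalPhysics.QuantumFieldTheory.Balaban1983to89.B6MultiLevelBoxOperatorL0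
open Literature.MathematicalPhysics.QuantumFieldTheory.Balaban1983to89.B6Eq238MultiLevelBox (MhP Pj one_le_Pj one_le_MhP
  Np_eq halfWidth_eq corner InCube uFun inCube_iff_exists_emb supNorm_lt_of_inCube uFun_eq_hΩ castP uX
  mul_diagonal_eq_sub_kComm term_algebra)

noncomputable section

variable {d : ℕ}

/-! ## §0 The support of the printed cut-off `h_□` at every mesh (`N = L^k·L·M_h ≥ 4`, `k ≥ 0`) -/

section Cutoffs

variable {ℓ k Mh : ℕ} {P : Fin (d + 1) → ℕ} {q : Fin (d + 1) → ℤ}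

/-- **THE SUPPORT OF `h_q` LIES IN `□_q`** at EVERY mesh exponent `k ≥ 0` provided `N = L^k·L·M_h ≥ 4` (its radius `⅝N`
is less than the half-width `N`) — the twin's `exists_emb_eq_of_hΩ_ne_zero` with `1 ≤ k` (used there only to get `N ≥ 4`)
replaced by `4 ≤ N`; covers the mesh-one cubes of level `0`.
[cite: Balaban1984PropagatorsI, (1.118) p.36 («h ∈ C₀^∞(]−⅔,⅔[)»); Balaban1983RegularityDecay, §2 p.575] -/
theorem exists_emb_eq_of_hΩ_ne_zero' (hN4 : 4 ≤ (ℓ + 1) ^ k * ((ℓ + 1) * Mh)) (hP : ∀ i, 1 ≤ P i)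
    (hq : q ∈ ctrs P) {z : ↥(Box d ℓ k (fun i => (ℓ + 1) * (Mh * P i)))} (hz : hΩ ℓ k Mh P q z ≠ 0) :
    ∃ x, emb ℓ k Mh P q hP hq x = z := by
  rw [emb, ← inSub_iff]
  set N : ℕ := (ℓ + 1) ^ k * ((ℓ + 1) * Mh) with hNdef
  have hN1 : 1 ≤ N := le_trans (by norm_num) hN4
  have hNr : (4 : ℝ) ≤ (N : ℝ) := by exact_mod_cast hN4
  have hzv := mem_boxDom.1 z.2
  intro i
  have hb := abs_lt_of_hq_ne_zero hN1 hz i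
  rw [abs_lt] at hb
  simp only [B6Partition236TwoLevelBox.pos] at hb
  obtain ⟨hb1, hb2⟩ := hb
  obtain ⟨hz0, hz1⟩ := hzv i
  have hqi := (mem_ctrs.1 hq) i
  have elo : (((ℓ + 1) ^ k : ℕ) : ℤ) * (cubeO ℓ Mh q i : ℤ) = (N : ℤ) * (cubeLo q i : ℤ) := by
    simp only [cubeO, hNdef]; push_cast; ring
  have ehi : (((ℓ + 1) ^ k : ℕ) : ℤ) * ((cubeO ℓ Mh q i : ℤ) + (((ℓ + 1) * cubeM' Mh P q i : ℕ) : ℤ))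
      = (N : ℤ) * ((cubeLo q i + cubeW P q i : ℕ) : ℤ) := by
    simp only [cubeO, cubeM', hNdef]; push_cast; ring
  rw [elo, ehi, cubeLo_add_cubeW_eq hP hq, cubeLo_eq hq]
  have hz1' : z.1 i < (N : ℤ) * (P i : ℤ) := by
    have : (((ℓ + 1) ^ k * ((ℓ + 1) * (Mh * P i)) : ℕ) : ℤ) = (N : ℤ) * (P i : ℤ) := by
      rw [hNdef]; push_cast; ring
    rw [← this]; exact_mod_cast hz1
  have hNz : (0 : ℤ) < N := by exact_mod_cast hN1
  constructor
  · rcases le_or_gt (q i) 0 with hq0 | hq0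
    · have : q i = 0 := le_antisymm hq0 hqi.1
      rw [this]; simp; exact hz0
    · rw [max_eq_left (by omega)]
      have hr : ((N : ℤ) * (q i - 1) : ℝ) < ((z.1 i : ℤ) : ℝ) := by
        push_cast; nlinarith
      have : (N : ℤ) * (q i - 1) < z.1 i := by exact_mod_cast hr
      exact this.le
  · rcases le_or_gt (P i : ℤ) (q i + 1) with hqP | hqP
    · rw [min_eq_right hqP]; exact hz1'
    · rw [min_eq_left hqP.le]
      have hr : ((z.1 i : ℤ) : ℝ) < ((N : ℤ) * (q i + 1) : ℝ) := by
        push_cast; nlinarith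
      exact_mod_cast hr

/-- **`h_q` VANISHES ON THE INTERNAL LAYER OF `□_q`** at every mesh with `N = L^k·L·M_h ≥ 4`
(`B6Partition236TwoLevelBox.hloc_eq_zero_low/high`). [cite: Balaban1983RegularityDecay, (2.6) p.576 («h_j can be ≠ 0 only on the part of the boundary of □_j which is contained in the boundary of Ω»)] -/
theorem hLoc_eq_zero_of_IL' (hN4 : 4 ≤ (ℓ + 1) ^ k * ((ℓ + 1) * Mh)) (hP : ∀ i, 1 ≤ P i) (hq : q ∈ ctrs P)
    {x : ↥(Box d ℓ k (fun i => (ℓ + 1) * cubeM' Mh P q i))} (hx : IL ℓ k Mh P q x) : hLoc ℓ k Mh P q x = 0 := by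
  set N : ℕ := (ℓ + 1) ^ k * ((ℓ + 1) * Mh) with hNdef
  obtain ⟨i, ⟨hx0, hlo⟩ | ⟨hxt, hhi⟩⟩ := hx
  · have hqi := (mem_ctrs.1 hq) i
    have hc : locLabel q i = 1 := by
      unfold locLabel; unfold cubeLo at hlo ⊢
      have e : ((q i).toNat : ℤ) = q i := Int.toNat_of_nonneg hqi.1
      omega
    exact hloc_eq_zero_low hN4 hc (le_of_eq hx0.symm) (by rw [hx0]; norm_num)
  · obtain ⟨hc, hw⟩ := cubeW_cases hP hq i
    have hw' : (cubeW P q i : ℤ) = locLabel q i + 1 := by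
      rcases hw with hw | ⟨hw, hc1⟩
      · exact hw
      · exfalso
        have hqi := (mem_ctrs.1 hq) i
        have hP' := hP i
        simp only [locLabel, cubeW, cubeLo] at hc1 hhi hw
        have e : ((q i).toNat : ℤ) = q i := Int.toNat_of_nonneg hqi.1
        omega
    refine hloc_eq_zero_high (M := (ℓ + 1) * Mh) (w := fun j => cubeW P q j) hN4 hw' (z := x.1) ?_
    have : (((ℓ + 1) ^ k * ((ℓ + 1) * cubeM' Mh P q i) : ℕ) : ℤ) = ((N * cubeW P q i : ℕ) : ℤ) := by
      rw [hNdef]; simp only [cubeM']; push_cast; ring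
    rw [← this]; omega

/-- the support condition of `diagonal_mul_eq_pad` for `h_q`, at every mesh with `N = L^k·L·M_h ≥ 4`.
[cite: Balaban1983RegularityDecay, (2.6) p.576] -/
theorem hΩ_support' (hN4 : 4 ≤ (ℓ + 1) ^ k * ((ℓ + 1) * Mh)) (hP : ∀ i, 1 ≤ P i) (hq : q ∈ ctrs P)
    (z : ↥(Box d ℓ k (fun i => (ℓ + 1) * (Mh * P i)))) (hz : hΩ ℓ k Mh P q z ≠ 0) :
    ∃ x, emb ℓ k Mh P q hP hq x = z ∧ ¬ IL ℓ k Mh P q x := by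
  obtain ⟨x, rfl⟩ := exists_emb_eq_of_hΩ_ne_zero' hN4 hP hq hz
  have hMh : 1 ≤ Mh := by
    rcases Nat.eq_zero_or_pos Mh with h0 | h0
    · rw [h0] at hN4; simp at hN4
    · exact h0
  refine ⟨x, rfl, fun hx => hz ?_⟩
  rw [hΩ_emb hMh hP hq, hLoc_eq_zero_of_IL' hN4 hP hq hx]

/-- the room condition of the cut-off support at every mesh exponent: the cube half-width `L^i·(L·M′)` («cubes □ of the size
2ML^jη») is `≥ 4` as soon as `L ≥ 2`, `M′ ≥ 2`. [cite: Balaban1984PropagatorsII, p.229 («cubes □ of the size 2ML^jη»), dictionary] -/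
theorem four_le_scale {ℓ i M' : ℕ} (hℓ : 1 ≤ ℓ) (hM : 2 ≤ M') : 4 ≤ (ℓ + 1) ^ i * ((ℓ + 1) * M') := by
  have h1 : 1 ≤ (ℓ + 1) ^ i := Nat.one_le_pow _ _ (by omega)
  have h2 : 4 ≤ (ℓ + 1) * M' := by nlinarith
  nlinarith

end Cutoffs

/-! ## §2 The level-`(i+1)` part of a presentation: `Λ = □^{(i)} ∩ B(Λ_{i+1})` globally (levels `0 … k`) -/

section Lam

variable {ℓ Mh k R : ℕ} {P : Fin (d + 1) → ℕ} (D : Domains d ℓ Mh k P R) (j i : ℕ)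

/-- **`Λ` OF (2.41) FOR THE PRESENTATION**: the unit (`i`-)blocks of the box whose sites lie in `B^{i+1}(Λ_{i+1})`
(«Λ = □^{(j)} ∩ B(Λ_{j+1})»), for a family with level `0`. [cite: Balaban1984PropagatorsII, (2.41) p.230 («where Λ = □^{(j)} ∩ B(Λ_{j+1})»)] -/
def LamG : Finset ↥(boxDom (fun μ => (ℓ + 1) * (MhP ℓ Mh j i * Pj ℓ k P j μ))) :=
  Finset.univ.filter fun y => D.lev (corner (ℓ := ℓ) i y.1) = i + 1

variable {D j i}

/-- the `L^i`-block index of a base corner is the unit block. [folklore] -/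
private theorem blk_corner' {i : ℕ} (y : Fin (d + 1) → ℤ) : blk ((ℓ + 1) ^ i) (corner (ℓ := ℓ) i y) = y := by
  funext μ
  have hb0 : (((ℓ + 1) ^ i : ℕ) : ℤ) ≠ 0 := by exact_mod_cast (show (ℓ + 1) ^ i ≠ 0 by positivity)
  simp only [blk, corner]
  exact Int.mul_ediv_cancel_left _ hb0

/-- the base corner of a unit block of a presentation is a site of the fine box. [folklore] -/
private theorem corner_mem' {M' : Fin (d + 1) → ℕ} {i : ℕ} (y : ↥(boxDom M')) :
    corner (ℓ := ℓ) i y.1 ∈ boxDom (fun μ => (ℓ + 1) ^ i * M' μ) := by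
  have hy := mem_boxDom.1 y.2
  rw [mem_boxDom]
  intro μ
  obtain ⟨h1, h2⟩ := hy μ
  have hn0 : (0 : ℤ) < (((ℓ + 1) ^ i : ℕ) : ℤ) := by positivity
  simp only [corner]
  push_cast
  push_cast at hn0
  exact ⟨by positivity, by nlinarith⟩

/-- membership in `Λ`: the block's corner lies at level `i + 1`. [cite: Balaban1984PropagatorsII, (2.41) p.230] -/
theorem mem_LamG (y : ↥(boxDom (fun μ => (ℓ + 1) * (MhP ℓ Mh j i * Pj ℓ k P j μ)))) :
    y ∈ LamG D j i ↔ Domains.lev D (corner (ℓ := ℓ) i y.1) = i + 1 := by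
  simp [LamG]

/-- the level of a site `x` at level `≥ i` is the level of the corner of its `i`-block (territories are unions of blocks,
`Domains.lev_eq_of_blk_eq_of_le`; at `i = 0` the block is the site). [cite: Balaban1984PropagatorsII, (2.1)+(2.3) p.224] -/
theorem lev_corner_ublk (hij : i ≤ j) (hjk : j ≤ k)
    (x : ↥(boxDom (fun μ => (ℓ + 1) ^ i * ((ℓ + 1) * (MhP ℓ Mh j i * Pj ℓ k P j μ))))) (hi : i ≤ D.lev x.1) :
    Domains.lev D (corner (ℓ := ℓ) i (blk ((ℓ + 1) ^ i) x.1)) = D.lev x.1 := by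
  have hn : 1 ≤ (ℓ + 1) ^ i := Nat.one_le_pow _ _ (by omega)
  have hN := Np_eq (ℓ := ℓ) (Mh := Mh) (P := P) hij hjk
  have hx : x.1 ∈ boxDom (N0 ℓ Mh k P) := hN ▸ x.2
  have hc : corner (ℓ := ℓ) i (blk ((ℓ + 1) ^ i) x.1) ∈ boxDom (N0 ℓ Mh k P) := by
    rw [← hN]
    exact corner_mem' (ublk hn x)
  exact D.lev_eq_of_blk_eq_of_le hx hc hi (by rw [blk_corner'])

/-- **`Λ` IS A UNION OF `L`-BLOCKS** (`B^{i+1}(Λ_{i+1})` is a union of `(i+1)`-blocks, `i ≥ 0`). [cite: Balaban1984PropagatorsII, p.230 («Λ = □^{(j)} ∩ B(Λ_{j+1})», a sum of blocks)] -/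
theorem isBlockUnion_LamG (hij : i ≤ j) (hjk : j ≤ k) :
    IsBlockUnion ℓ (fun μ => MhP ℓ Mh j i * Pj ℓ k P j μ) (LamG D j i) := by
  have hn : 1 ≤ (ℓ + 1) ^ i := Nat.one_le_pow _ _ (by omega)
  have hN := Np_eq (ℓ := ℓ) (Mh := Mh) (P := P) hij hjk
  intro y hy y' hyy'
  rw [mem_LamG] at hy ⊢
  have hcy : corner (ℓ := ℓ) i y.1 ∈ boxDom (N0 ℓ Mh k P) := by rw [← hN]; exact corner_mem' y
  have hcy' : corner (ℓ := ℓ) i y'.1 ∈ boxDom (N0 ℓ Mh k P) := by rw [← hN]; exact corner_mem' y'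
  rw [← hy]
  refine D.lev_eq_of_blk_eq hcy hcy' ?_
  rw [hy, pow_succ, ← blk_blk (ℓ + 1) ((ℓ + 1) ^ i) (corner i y'.1), ← blk_blk (ℓ + 1) ((ℓ + 1) ^ i) (corner i y.1),
    blk_corner', blk_corner', hyy']

end Lam

/-! ## §3 Localisation: the multi-level operator restricted to a cube is a two-level cube operator ([3] (2.6)), `i ≥ 0` -/

section Localisation

variable {ℓ Mh k R : ℕ} {P : Fin (d + 1) → ℕ} (D : Domains d ℓ Mh k P R) (a c : ℕ → ℝ) (j i : ℕ)
  (q : Fin (d + 1) → ℤ)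

/-- the presentation of `Δ′_a` at mesh exponent `i` for level-`j` cubes (family with level `0`). [cite: Balaban1984PropagatorsII, (2.13)–(2.14) p.225 with p.230 (rescaling)] -/
def Ep : Matrix ↥(Box d ℓ i (fun μ => (ℓ + 1) * (MhP ℓ Mh j i * Pj ℓ k P j μ)))
    ↥(Box d ℓ i (fun μ => (ℓ + 1) * (MhP ℓ Mh j i * Pj ℓ k P j μ))) ℝ :=
  mlOp (fun μ => (ℓ + 1) ^ i * ((ℓ + 1) * (MhP ℓ Mh j i * Pj ℓ k P j μ))) ℓ k D.lev a

/-- **THE TWO-LEVEL CUBE OPERATOR OF THE CUT CUBE `□_q`** (levels `i`, `i + 1`, `i ≥ 0`; `m² = 0`):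
`twoLevelOp (L^i) ℓ a_i c_i 0 (cubeM′) Λ_q` of `B6Ineq243TwoLevelBox` — at `i = 0` the mesh-one member `−Δ + a₀(1 − 1_Λ) +
a₁L^{−2}·ΛPΛ`. [cite: Balaban1984PropagatorsII, (2.41) p.230] -/
def cOp (hP : ∀ μ, 1 ≤ P μ) (hq : q ∈ ctrs (Pj ℓ k P j)) :=
  twoLevelOp ((ℓ + 1) ^ i) ℓ (a i) (c i) 0 (cubeM' (MhP ℓ Mh j i) (Pj ℓ k P j) q)
    (lamLoc ℓ (MhP ℓ Mh j i) (Pj ℓ k P j) q (one_le_Pj hP j) hq (LamG D j i))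

/-- **THE GENUINE CUBE PROPAGATOR `G′(□_q)`** (`B6Ineq243TwoLevelBox.gTwoLevel`, the Woodbury inverse (2.42)), `i ≥ 0`.
[cite: Balaban1984PropagatorsII, (2.37) p.229, (2.42) p.230] -/
def cG (hP : ∀ μ, 1 ≤ P μ) (hq : q ∈ ctrs (Pj ℓ k P j)) :=
  gTwoLevel ((ℓ + 1) ^ i) ℓ (a i) (c i) 0 (cubeM' (MhP ℓ Mh j i) (Pj ℓ k P j) q)
    (lamLoc ℓ (MhP ℓ Mh j i) (Pj ℓ k P j) q (one_le_Pj hP j) hq (LamG D j i))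

variable {D a c j i q}

/-- `E_qG′(□_q) = 1` (`twoLevelOp_mul_gTwoLevel`), every mesh exponent `i ≥ 0`. [cite: Balaban1984PropagatorsII, (2.41)–(2.42) p.230] -/
theorem cOp_mul_cG (hℓ : 1 ≤ ℓ) (hP : ∀ μ, 1 ≤ P μ) (hMh : 1 ≤ Mh) (hq : q ∈ ctrs (Pj ℓ k P j))
    (hij : i ≤ j) (hjk : j ≤ k) (hai : 0 < a i) (hci : 0 < c i) :
    cOp D a c j i q hP hq * cG D a c j i q hP hq = 1 := by
  have hn : 1 ≤ (ℓ + 1) ^ i := Nat.one_le_pow _ _ (by omega)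
  have hM' : ∀ μ, 1 ≤ cubeM' (MhP ℓ Mh j i) (Pj ℓ k P j) q μ := fun μ =>
    Nat.one_le_iff_ne_zero.2 (Nat.mul_ne_zero_iff.2
      ⟨by have := one_le_MhP (ℓ := ℓ) hMh j i; omega, by have := (one_le_cubeW (one_le_Pj hP j) hq μ).1; omega⟩)
  exact twoLevelOp_mul_gTwoLevel hn hℓ hai hci le_rfl hM' (isBlockUnion_lamLoc _ hq (isBlockUnion_LamG hij hjk))

/-- **THE ENTRIES OF `L^{2i}·Δ′_a` AT AN EMBEDDED PAIR ARE THE ENTRIES OF THE CUBE OPERATOR** (off the internal layer),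
when every site of the cut cube has level `i` or `i + 1` (`i ≥ 0`): the Laplacian part by [3] (2.6) (`degree_eq_of_not_IL`),
the level-`i` averaging term is `a_iQ_i^*Q_i` of the cube (`Q₀ = id` at `i = 0`), the level-`(i+1)` term is «the additional
factor L^{−2}» term with `a_{i+1} = aNext ℓ a_i c_i`. [cite: Balaban1984PropagatorsII, (2.40)–(2.41) p.230; Balaban1983RegularityDecay, (2.6) p.576] -/
theorem mlOp_emb_emb (hℓ : 1 ≤ ℓ) (hP : ∀ μ, 1 ≤ P μ) (hq : q ∈ ctrs (Pj ℓ k P j)) (hij : i ≤ j) (hjk : j ≤ k)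
    (hac : a (i + 1) = aNext ℓ (a i) (c i))
    (hwin : ∀ b : ↥(Box d ℓ i (fun μ => (ℓ + 1) * cubeM' (MhP ℓ Mh j i) (Pj ℓ k P j) q μ)),
      D.lev (emb ℓ i (MhP ℓ Mh j i) (Pj ℓ k P j) q (one_le_Pj hP j) hq b).1 = i ∨
        D.lev (emb ℓ i (MhP ℓ Mh j i) (Pj ℓ k P j) q (one_le_Pj hP j) hq b).1 = i + 1)
    {x : ↥(Box d ℓ i (fun μ => (ℓ + 1) * cubeM' (MhP ℓ Mh j i) (Pj ℓ k P j) q μ))}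
    (hx : ¬ IL ℓ i (MhP ℓ Mh j i) (Pj ℓ k P j) q x)
    (b : ↥(Box d ℓ i (fun μ => (ℓ + 1) * cubeM' (MhP ℓ Mh j i) (Pj ℓ k P j) q μ))) :
    ((((ℓ : ℝ) + 1)) ^ i) ^ 2 * Ep D a j i (emb ℓ i (MhP ℓ Mh j i) (Pj ℓ k P j) q (one_le_Pj hP j) hq x)
        (emb ℓ i (MhP ℓ Mh j i) (Pj ℓ k P j) q (one_le_Pj hP j) hq b)
      = cOp D a c j i q hP hq x b := by
  have hn1 : 1 ≤ (ℓ + 1) ^ i := Nat.one_le_pow _ _ (by omega)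
  have hL : 1 ≤ (ℓ + 1) ^ i * (ℓ + 1) := Nat.one_le_iff_ne_zero.2 (by positivity)
  have hN := Np_eq (ℓ := ℓ) (Mh := Mh) (P := P) hij hjk
  have hinj := emb_injective (ℓ := ℓ) (k := i) (Mh := (MhP ℓ Mh j i)) (one_le_Pj hP j) hq
  unfold Ep cOp
  rw [mlOp_apply D hN, twoLevelOp_apply hn1 _ _ _ (isBlockUnion_lamLoc (one_le_Pj hP j) hq (isBlockUnion_LamG hij hjk))]
  -- (i) the Laplacian entries ([3] (2.6))
  have hval : ∀ e : ↥(Box d ℓ i (fun μ => (ℓ + 1) * cubeM' (MhP ℓ Mh j i) (Pj ℓ k P j) q μ)),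
      (emb ℓ i (MhP ℓ Mh j i) (Pj ℓ k P j) q (one_le_Pj hP j) hq e).1 = e.1 + fun μ => (((ℓ + 1) ^ i : ℕ) : ℤ) * (cubeO ℓ (MhP ℓ Mh j i) q μ : ℤ) := emb_val' (one_le_Pj hP j) hq
  have hlap : (neumannLapK (fun μ => (ℓ + 1) ^ i * ((ℓ + 1) * ((MhP ℓ Mh j i) * (Pj ℓ k P j) μ))) (emb ℓ i (MhP ℓ Mh j i) (Pj ℓ k P j) q (one_le_Pj hP j) hq x).1
        (emb ℓ i (MhP ℓ Mh j i) (Pj ℓ k P j) q (one_le_Pj hP j) hq b).1 : ℝ)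
      = neumannLapK (fun μ => (ℓ + 1) ^ i * ((ℓ + 1) * cubeM' (MhP ℓ Mh j i) (Pj ℓ k P j) q μ)) x.1 b.1 := by
    unfold neumannLapK
    have e1 : ((emb ℓ i (MhP ℓ Mh j i) (Pj ℓ k P j) q (one_le_Pj hP j) hq b).1 = (emb ℓ i (MhP ℓ Mh j i) (Pj ℓ k P j) q (one_le_Pj hP j) hq x).1) ↔ (b.1 = x.1) := by
      constructor
      · intro h; exact congrArg Subtype.val (hinj (Subtype.ext h))
      · intro h; rw [show b = x from Subtype.ext h]
    have e2 : ((emb ℓ i (MhP ℓ Mh j i) (Pj ℓ k P j) q (one_le_Pj hP j) hq b).1 ∈ nbrs (emb ℓ i (MhP ℓ Mh j i) (Pj ℓ k P j) q (one_le_Pj hP j) hq x).1) ↔ (b.1 ∈ nbrs x.1) := by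
      rw [hval, hval, mem_nbrs_add_iff]
    simp only [e1, e2, degree_eq_of_not_IL (one_le_Pj hP j) hq hx]
  -- (ii) the block conditions transported along the embedding
  have hbL : (blk ((ℓ + 1) ^ i * (ℓ + 1)) (emb ℓ i (MhP ℓ Mh j i) (Pj ℓ k P j) q (one_le_Pj hP j) hq b).1
        = blk ((ℓ + 1) ^ i * (ℓ + 1)) (emb ℓ i (MhP ℓ Mh j i) (Pj ℓ k P j) q (one_le_Pj hP j) hq x).1)
      ↔ (blk ((ℓ + 1) ^ i * (ℓ + 1)) b.1 = blk ((ℓ + 1) ^ i * (ℓ + 1)) x.1) := by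
    rw [emb_val'' (one_le_Pj hP j) hq, emb_val'' (one_le_Pj hP j) hq, blk_add_mul hL, blk_add_mul hL]
    constructor
    · intro h; exact add_right_cancel h
    · intro h; rw [h]
  have hb1 : (blk ((ℓ + 1) ^ i) (emb ℓ i (MhP ℓ Mh j i) (Pj ℓ k P j) q (one_le_Pj hP j) hq b).1 = blk ((ℓ + 1) ^ i) (emb ℓ i (MhP ℓ Mh j i) (Pj ℓ k P j) q (one_le_Pj hP j) hq x).1)
      ↔ (blk ((ℓ + 1) ^ i) b.1 = blk ((ℓ + 1) ^ i) x.1) := by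
    rw [hval, hval, blk_add_mul hn1, blk_add_mul hn1]
    constructor
    · intro h; exact add_right_cancel h
    · intro h; rw [h]
  -- (iii) membership of the unit block of `x` in `Λ_q` ↔ level `i + 1`
  have hub : (ublk hn1 (M := fun μ => (ℓ + 1) * cubeM' (MhP ℓ Mh j i) (Pj ℓ k P j) q μ) x ∈ lamLoc ℓ (MhP ℓ Mh j i) (Pj ℓ k P j) q (one_le_Pj hP j) hq (LamG D j i))
      ↔ D.lev (emb ℓ i (MhP ℓ Mh j i) (Pj ℓ k P j) q (one_le_Pj hP j) hq x).1 = i + 1 := by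
    have h1 : (ublk hn1 (M := fun μ => (ℓ + 1) * ((MhP ℓ Mh j i) * (Pj ℓ k P j) μ)) (emb ℓ i (MhP ℓ Mh j i) (Pj ℓ k P j) q (one_le_Pj hP j) hq x) ∈ LamG D j i)
        ↔ (ublk hn1 (M := fun μ => (ℓ + 1) * cubeM' (MhP ℓ Mh j i) (Pj ℓ k P j) q μ) x ∈ lamLoc ℓ (MhP ℓ Mh j i) (Pj ℓ k P j) q (one_le_Pj hP j) hq (LamG D j i)) := by
      rw [ublk_emb hn1 rfl (one_le_Pj hP j) hq x]
      simp [lamLoc]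
    rw [← h1, mem_LamG]
    have hi : i ≤ D.lev (emb ℓ i (MhP ℓ Mh j i) (Pj ℓ k P j) q (one_le_Pj hP j) hq x).1 := by rcases hwin x with h | h <;> omega
    exact Iff.of_eq (congrArg (fun t => t = i + 1) (lev_corner_ublk (D := D) hij hjk _ hi))
  rw [hlap]
  have hdiag : (diagK (0 : ℝ) x.1 b.1) = 0 := by unfold diagK; split_ifs <;> rfl
  rw [hdiag, add_zero, mul_add]
  have hn2 : ((((ℓ : ℝ) + 1)) ^ i) ^ 2 = ((((ℓ + 1) ^ i : ℕ) : ℝ)) ^ 2 := by push_cast; ring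
  rw [hn2]
  congr 1
  -- (iv) the averaging entries, by the level of `x`
  rcases hwin x with hlx | hlx
  · -- level `i`: the block of `x` is not in `Λ_q`; the term is `a_iQ_i^*Q_i`
    have hnot : ¬ (ublk hn1 (M := fun μ => (ℓ + 1) * cubeM' (MhP ℓ Mh j i) (Pj ℓ k P j) q μ) x
        ∈ lamLoc ℓ (MhP ℓ Mh j i) (Pj ℓ k P j) q (one_le_Pj hP j) hq (LamG D j i)) := by
      rw [hub]; omega
    rw [if_neg hnot, hlx]
    unfold avgK
    simp only [hb1]
    split_ifs
    · unfold levC; push_cast; field_simp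
    · rw [mul_zero]
  · -- level `i + 1`: the block of `x` is in `Λ_q`; the term is `a_{i+1}L^{−2}Q_{i+1}^*Q_{i+1}`
    have hmem : ublk hn1 (M := fun μ => (ℓ + 1) * cubeM' (MhP ℓ Mh j i) (Pj ℓ k P j) q μ) x
        ∈ lamLoc ℓ (MhP ℓ Mh j i) (Pj ℓ k P j) q (one_le_Pj hP j) hq (LamG D j i) := by
      rw [hub]; exact hlx
    rw [if_pos hmem, hlx]
    unfold avgK
    rw [pow_succ (ℓ + 1) i]
    simp only [hbL]
    split_ifs
    · unfold levC; rw [hac]; push_cast; field_simp; ring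
    · rw [mul_zero]

/-- **THE ENTRIES OF `Δ′_a` FROM AN EMBEDDED SITE TO A SITE OUTSIDE THE CUBE VANISH** (off the internal layer; `i ≥ 0`): not
a neighbour ([3] (2.6)) and no common block of level `i` or `i + 1`. [cite: Balaban1983RegularityDecay, (2.6) p.576] -/
theorem mlOp_emb_off (hP : ∀ μ, 1 ≤ P μ) (hq : q ∈ ctrs (Pj ℓ k P j)) (hij : i ≤ j) (hjk : j ≤ k)
    (hwin : ∀ b : ↥(Box d ℓ i (fun μ => (ℓ + 1) * cubeM' (MhP ℓ Mh j i) (Pj ℓ k P j) q μ)),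
      D.lev (emb ℓ i (MhP ℓ Mh j i) (Pj ℓ k P j) q (one_le_Pj hP j) hq b).1 = i ∨
        D.lev (emb ℓ i (MhP ℓ Mh j i) (Pj ℓ k P j) q (one_le_Pj hP j) hq b).1 = i + 1)
    {x : ↥(Box d ℓ i (fun μ => (ℓ + 1) * cubeM' (MhP ℓ Mh j i) (Pj ℓ k P j) q μ))}
    (hx : ¬ IL ℓ i (MhP ℓ Mh j i) (Pj ℓ k P j) q x)
    {z : ↥(Box d ℓ i (fun μ => (ℓ + 1) * (MhP ℓ Mh j i * Pj ℓ k P j μ)))}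
    (hz : ∀ b, emb ℓ i (MhP ℓ Mh j i) (Pj ℓ k P j) q (one_le_Pj hP j) hq b ≠ z) :
    Ep D a j i (emb ℓ i (MhP ℓ Mh j i) (Pj ℓ k P j) q (one_le_Pj hP j) hq x) z = 0 := by
  have hn1 : 1 ≤ (ℓ + 1) ^ i := Nat.one_le_pow _ _ (by omega)
  have hN := Np_eq (ℓ := ℓ) (Mh := Mh) (P := P) hij hjk
  unfold Ep
  rw [mlOp_apply D hN]
  have hne : z.1 ≠ (emb ℓ i (MhP ℓ Mh j i) (Pj ℓ k P j) q (one_le_Pj hP j) hq x).1 := fun h => hz x (Subtype.ext h.symm)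
  have hnb : z.1 ∉ nbrs (emb ℓ i (MhP ℓ Mh j i) (Pj ℓ k P j) q (one_le_Pj hP j) hq x).1 := fun h => by
    obtain ⟨b, hb⟩ := exists_emb_eq_of_nbr (one_le_Pj hP j) hq hx h
    exact hz b hb
  have hlap : (neumannLapK (fun μ => (ℓ + 1) ^ i * ((ℓ + 1) * ((MhP ℓ Mh j i) * (Pj ℓ k P j) μ))) (emb ℓ i (MhP ℓ Mh j i) (Pj ℓ k P j) q (one_le_Pj hP j) hq x).1 z.1 : ℝ)
      = 0 := by
    unfold neumannLapK; rw [if_neg hne, if_neg hnb]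
  have hbL : blk ((ℓ + 1) ^ i * (ℓ + 1)) z.1 ≠ blk ((ℓ + 1) ^ i * (ℓ + 1)) (emb ℓ i (MhP ℓ Mh j i) (Pj ℓ k P j) q (one_le_Pj hP j) hq x).1 := fun h => by
    obtain ⟨b, hb⟩ := exists_emb_eq_of_blkL (one_le_Pj hP j) hq x h
    exact hz b hb
  have hb1 : blk ((ℓ + 1) ^ i) z.1 ≠ blk ((ℓ + 1) ^ i) (emb ℓ i (MhP ℓ Mh j i) (Pj ℓ k P j) q (one_le_Pj hP j) hq x).1 := fun h => by
    obtain ⟨b, hb⟩ := exists_emb_eq_of_blk (one_le_Pj hP j) hq x h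
    exact hz b hb
  rw [hlap, zero_add]
  unfold avgK
  rcases hwin x with hlx | hlx
  · rw [hlx, if_neg hb1]
  · rw [hlx, pow_succ, if_neg hbL]

/-- **LOCALISATION, ROW FORM**: off the internal layer, the row of `L^{2i}·Δ′_a` at `emb x` is the row of the padded cube
operator `resᵀ·E_q·res` (`i ≥ 0`). [cite: Balaban1984PropagatorsII, (2.37)–(2.38) p.229 with [3] (2.6) p.576] -/
theorem row_eq_pad_row (hℓ : 1 ≤ ℓ) (hP : ∀ μ, 1 ≤ P μ) (hq : q ∈ ctrs (Pj ℓ k P j)) (hij : i ≤ j) (hjk : j ≤ k)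
    (hac : a (i + 1) = aNext ℓ (a i) (c i))
    (hwin : ∀ b : ↥(Box d ℓ i (fun μ => (ℓ + 1) * cubeM' (MhP ℓ Mh j i) (Pj ℓ k P j) q μ)),
      D.lev (emb ℓ i (MhP ℓ Mh j i) (Pj ℓ k P j) q (one_le_Pj hP j) hq b).1 = i ∨
        D.lev (emb ℓ i (MhP ℓ Mh j i) (Pj ℓ k P j) q (one_le_Pj hP j) hq b).1 = i + 1)
    {x : ↥(Box d ℓ i (fun μ => (ℓ + 1) * cubeM' (MhP ℓ Mh j i) (Pj ℓ k P j) q μ))}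
    (hx : ¬ IL ℓ i (MhP ℓ Mh j i) (Pj ℓ k P j) q x)
    (z : ↥(Box d ℓ i (fun μ => (ℓ + 1) * (MhP ℓ Mh j i * Pj ℓ k P j μ)))) :
    ((((ℓ : ℝ) + 1)) ^ i) ^ 2 * Ep D a j i (emb ℓ i (MhP ℓ Mh j i) (Pj ℓ k P j) q (one_le_Pj hP j) hq x) z
      = ((res (emb ℓ i (MhP ℓ Mh j i) (Pj ℓ k P j) q (one_le_Pj hP j) hq))ᵀ * cOp D a c j i q hP hq
          * res (emb ℓ i (MhP ℓ Mh j i) (Pj ℓ k P j) q (one_le_Pj hP j) hq))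
          (emb ℓ i (MhP ℓ Mh j i) (Pj ℓ k P j) q (one_le_Pj hP j) hq x) z := by
  have hinj := emb_injective (ℓ := ℓ) (k := i) (Mh := MhP ℓ Mh j i) (one_le_Pj hP j) hq
  rw [Matrix.mul_assoc, transpose_res_mul_apply_img hinj]
  by_cases hz : ∃ b, emb ℓ i (MhP ℓ Mh j i) (Pj ℓ k P j) q (one_le_Pj hP j) hq b = z
  · obtain ⟨b, rfl⟩ := hz
    rw [mul_res_apply_img hinj, mlOp_emb_emb hℓ hP hq hij hjk hac hwin hx b]
  · push Not at hz
    rw [mul_res_apply_off _ _ _ hz, mlOp_emb_off hP hq hij hjk hwin hx hz, mul_zero]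

/-- **LOCALISATION, OPERATOR FORM ([3] (2.6) for the multi-level operator with level `0`)**: for every multiplication
operator `h` on the box supported in `□_q` off its internal layer, `h·(L^{2i}Δ′_a) = h·(resᵀE_q res)`. [cite: Balaban1984PropagatorsII, (2.38) p.229; Balaban1983RegularityDecay, (2.6) p.576] -/
theorem diagonal_mul_eq_pad (hℓ : 1 ≤ ℓ) (hP : ∀ μ, 1 ≤ P μ) (hq : q ∈ ctrs (Pj ℓ k P j)) (hij : i ≤ j) (hjk : j ≤ k)
    (hac : a (i + 1) = aNext ℓ (a i) (c i))
    (hwin : ∀ b : ↥(Box d ℓ i (fun μ => (ℓ + 1) * cubeM' (MhP ℓ Mh j i) (Pj ℓ k P j) q μ)),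
      D.lev (emb ℓ i (MhP ℓ Mh j i) (Pj ℓ k P j) q (one_le_Pj hP j) hq b).1 = i ∨
        D.lev (emb ℓ i (MhP ℓ Mh j i) (Pj ℓ k P j) q (one_le_Pj hP j) hq b).1 = i + 1)
    (h : ↥(Box d ℓ i (fun μ => (ℓ + 1) * (MhP ℓ Mh j i * Pj ℓ k P j μ))) → ℝ)
    (hh : ∀ z, h z ≠ 0 → ∃ x, emb ℓ i (MhP ℓ Mh j i) (Pj ℓ k P j) q (one_le_Pj hP j) hq x = z ∧
      ¬ IL ℓ i (MhP ℓ Mh j i) (Pj ℓ k P j) q x) :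
    Matrix.diagonal h * (((((ℓ : ℝ) + 1)) ^ i) ^ 2 • Ep D a j i)
      = Matrix.diagonal h * ((res (emb ℓ i (MhP ℓ Mh j i) (Pj ℓ k P j) q (one_le_Pj hP j) hq))ᵀ
          * cOp D a c j i q hP hq * res (emb ℓ i (MhP ℓ Mh j i) (Pj ℓ k P j) q (one_le_Pj hP j) hq)) := by
  ext z z'
  rw [Matrix.diagonal_mul, Matrix.diagonal_mul]
  by_cases hz : h z = 0
  · rw [hz, zero_mul, zero_mul]
  · obtain ⟨x, rfl, hx⟩ := hh z hz
    rw [Matrix.smul_apply, smul_eq_mul, row_eq_pad_row hℓ hP hq hij hjk hac hwin hx]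

end Localisation

/-! ## §4 One term of (2.38): `Δ′_a·(h_□G′(□)v) = h_□v − resᵀ(K_□(h_□)G′(□)v)res`, every mesh exponent `i ≥ 0` -/

section OneTerm

variable {ℓ Mh k R : ℕ} {P : Fin (d + 1) → ℕ} {D : Domains d ℓ Mh k P R} {a c : ℕ → ℝ} {j i : ℕ}
  {q : Fin (d + 1) → ℤ}

/-- **ONE TERM OF (2.38) FOR THE MULTI-LEVEL OPERATOR WITH LEVEL `0`**: for the cut cube `□_q` of level `j` (finer level
`i ≥ 0`, two-level window), the printed left cut-off `h_□ = hΩ`, the genuine cube propagator `G′(□) = L^{2i}·gTwoLevel` padded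
by zero and ANY right factor `v`:  `Δ′_a·(h_□ G′(□) v) = h_□v − resᵀ·(K_□(h_□)·gTwoLevel·(v∘emb))·res` — localisation [3] (2.6),
`E_□G′(□) = 1` and `res·resᵀ = 1`; `M_h ≥ 2` gives the room `L^i·M ≥ 4` the cut-off support needs at every `i ≥ 0`.
[cite: Balaban1984PropagatorsII, (2.37)–(2.38) p.229, (2.40) p.230] -/
theorem mlOp_mul_term (hℓ : 1 ≤ ℓ) (hP : ∀ μ, 1 ≤ P μ) (hMh : 2 ≤ Mh) (hq : q ∈ ctrs (Pj ℓ k P j))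
    (hij : i ≤ j) (hjk : j ≤ k) (hai : 0 < a i) (hci : 0 < c i)
    (hac : a (i + 1) = aNext ℓ (a i) (c i))
    (hwin : ∀ b : ↥(Box d ℓ i (fun μ => (ℓ + 1) * cubeM' (MhP ℓ Mh j i) (Pj ℓ k P j) q μ)),
      D.lev (emb ℓ i (MhP ℓ Mh j i) (Pj ℓ k P j) q (one_le_Pj hP j) hq b).1 = i ∨
        D.lev (emb ℓ i (MhP ℓ Mh j i) (Pj ℓ k P j) q (one_le_Pj hP j) hq b).1 = i + 1)
    (v : ↥(Box d ℓ i (fun μ => (ℓ + 1) * (MhP ℓ Mh j i * Pj ℓ k P j μ))) → ℝ) :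
    Ep D a j i * (Matrix.diagonal (hΩ ℓ i (MhP ℓ Mh j i) (Pj ℓ k P j) q)
        * ((res (emb ℓ i (MhP ℓ Mh j i) (Pj ℓ k P j) q (one_le_Pj hP j) hq))ᵀ
            * (((((ℓ : ℝ) + 1)) ^ i) ^ 2 • cG D a c j i q hP hq)
            * res (emb ℓ i (MhP ℓ Mh j i) (Pj ℓ k P j) q (one_le_Pj hP j) hq))
        * Matrix.diagonal v)
      = Matrix.diagonal (fun z => hΩ ℓ i (MhP ℓ Mh j i) (Pj ℓ k P j) q z * v z)
        - (res (emb ℓ i (MhP ℓ Mh j i) (Pj ℓ k P j) q (one_le_Pj hP j) hq))ᵀ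
          * (kComm (cOp D a c j i q hP hq) (hLoc ℓ i (MhP ℓ Mh j i) (Pj ℓ k P j) q) * cG D a c j i q hP hq
              * Matrix.diagonal (v ∘ emb ℓ i (MhP ℓ Mh j i) (Pj ℓ k P j) q (one_le_Pj hP j) hq))
          * res (emb ℓ i (MhP ℓ Mh j i) (Pj ℓ k P j) q (one_le_Pj hP j) hq) := by
  have hMh1 : 1 ≤ Mh := le_trans (by norm_num) hMh
  have hMh' : 1 ≤ MhP ℓ Mh j i := one_le_MhP hMh1 j i
  have hMh2 : 2 ≤ MhP ℓ Mh j i := le_trans hMh (Nat.le_mul_of_pos_right _ (by positivity))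
  have hN4 : 4 ≤ (ℓ + 1) ^ i * ((ℓ + 1) * MhP ℓ Mh j i) := four_le_scale hℓ hMh2
  have hinj := emb_injective (ℓ := ℓ) (k := i) (Mh := MhP ℓ Mh j i) (one_le_Pj hP j) hq
  have hloc := diagonal_mul_eq_pad (D := D) (a := a) (c := c) hℓ hP hq hij hjk hac hwin
    (hΩ ℓ i (MhP ℓ Mh j i) (Pj ℓ k P j) q) (hΩ_support' hN4 (one_le_Pj hP j) hq)
  have hE : (Ep D a j i)ᵀ = Ep D a j i := (mlOp_isSymm _ _ _ _).eq
  have hC : (cOp D a c j i q hP hq)ᵀ = cOp D a c j i q hP hq := (twoLevelOp_isSymm _ _ _ _ _ _ _).eq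
  have hEG := cOp_mul_cG (D := D) (a := a) (c := c) hℓ hP hMh1 hq hij hjk hai hci
  rw [term_algebra hinj _ _ _ _ v _ hloc hE hC hEG
    (fun z hz => exists_emb_eq_of_hΩ_ne_zero' hN4 (one_le_Pj hP j) hq hz), kComm,
    hΩ_comp_emb (ℓ := ℓ) (k := i) hMh' (one_le_Pj hP j) hq]

end OneTerm

/-! ## §5 The cover 𝒟 of p. 229 on the box («for all j from 0 to k»), the window of an active cube -/

section Cover

variable {ℓ Mh k R : ℕ} {P : Fin (d + 1) → ℕ} (D : Domains d ℓ Mh k P R)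

/-- **ACTIVE CUBES**: the level-`j` cube `(j, q)` (`j ≥ 0`) enters the cover iff its profile meets `B^j(Λ_j)` («center y ∈ Λ_j
(more exactly it belongs to the boundary of this set also)»). [cite: Balaban1984PropagatorsII, p.229] -/
def Active (j : ℕ) (q : Fin (d + 1) → ℤ) : Prop :=
  ∃ z ∈ boxDom (N0 ℓ Mh k P), D.lev z = j ∧ uFun ℓ Mh j q z ≠ 0

/-- the cube meets the territory of the level below («□ ⊂ B^j(Λ_j)» fails downwards; never at `j = 0`). [cite: Balaban1984PropagatorsII, p.230] -/
def Down (j : ℕ) (q : Fin (d + 1) → ℤ) : Prop :=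
  ∃ z ∈ boxDom (N0 ℓ Mh k P), InCube ℓ Mh k P j q z ∧ D.lev z + 1 = j

open Classical in
/-- **THE FINER LEVEL OF THE CUBE**: `j − 1` if it meets `B^{j−1}(Λ_{j−1})`, else `j` («□ … intersecting maybe the domain
B^{j+1}(Λ_{j+1})»); `0` for a level-`1` cube meeting `Λ₀` and for every level-`0` cube. [cite: Balaban1984PropagatorsII, p.230] -/
def fin (j : ℕ) (q : Fin (d + 1) → ℤ) : ℕ := if Down D j q then j - 1 else j

variable {D}

/-- **THE TWO-LEVEL WINDOW OF AN ACTIVE CUBE** (from (2.2) via `Domains.lev_window/not_both_sides`, `R ≥ 2L`), level `0`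
admitted: if the finer level `i` is `j − 1` when the cube meets `B^{j−1}(Λ_{j−1})` and `j` otherwise, every site of the cut cube
has level `i` or `i + 1`; `M_h ≥ 2` (room for the cut-off support at `i = 0`). [cite: Balaban1984PropagatorsII, (2.2) p.224 with p.230 («intersecting maybe the domain B^{j+1}(Λ_{j+1})»)] -/
theorem window_of_active (hℓ : 1 ≤ ℓ) (hR : 2 * (ℓ + 1) ≤ R) (hP : ∀ μ, 1 ≤ P μ) (hMh : 2 ≤ Mh) {j i : ℕ}
    (hij : i ≤ j) (hjk : j ≤ k) {q : Fin (d + 1) → ℤ} (hq : q ∈ ctrs (Pj ℓ k P j))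
    (hact : Active D j q) (hdown : Down D j q → i + 1 = j) (hup : ¬ Down D j q → i = j)
    (b : ↥(Box d ℓ i (fun μ => (ℓ + 1) * cubeM' (MhP ℓ Mh j i) (Pj ℓ k P j) q μ))) :
    D.lev (emb ℓ i (MhP ℓ Mh j i) (Pj ℓ k P j) q (one_le_Pj hP j) hq b).1 = i ∨
      D.lev (emb ℓ i (MhP ℓ Mh j i) (Pj ℓ k P j) q (one_le_Pj hP j) hq b).1 = i + 1 := by
  have hN := Np_eq (ℓ := ℓ) (Mh := Mh) (P := P) hij hjk
  have hMh2 : 2 ≤ MhP ℓ Mh j i := le_trans hMh (Nat.le_mul_of_pos_right _ (by positivity))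
  have hN4 : 4 ≤ (ℓ + 1) ^ i * ((ℓ + 1) * MhP ℓ Mh j i) := four_le_scale hℓ hMh2
  obtain ⟨t, ht, htj, htu⟩ := hact
  -- the witness `t` lies in the cube
  have htmem : t ∈ Box d ℓ i (fun μ => (ℓ + 1) * (MhP ℓ Mh j i * Pj ℓ k P j μ)) := mem_boxDom_of_eq hN.symm ht
  have htΩ : hΩ ℓ i (MhP ℓ Mh j i) (Pj ℓ k P j) q ⟨t, htmem⟩ ≠ 0 := by
    rw [← uFun_eq_hΩ hij q ⟨t, htmem⟩]; exact htu
  obtain ⟨x₀, hx₀⟩ := exists_emb_eq_of_hΩ_ne_zero' hN4 (one_le_Pj hP j) hq htΩ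
  have htcube : InCube ℓ Mh k P j q t :=
    (inCube_iff_exists_emb (Mh := Mh) hP hij hq ⟨t, htmem⟩).2 ⟨x₀, hx₀⟩
  have hbcube : InCube ℓ Mh k P j q (emb ℓ i (MhP ℓ Mh j i) (Pj ℓ k P j) q (one_le_Pj hP j) hq b).1 :=
    (inCube_iff_exists_emb (Mh := Mh) hP hij hq _).2 ⟨b, rfl⟩
  have hbmem : (emb ℓ i (MhP ℓ Mh j i) (Pj ℓ k P j) q (one_le_Pj hP j) hq b).1 ∈ boxDom (N0 ℓ Mh k P) :=
    mem_boxDom_of_eq hN (emb ℓ i (MhP ℓ Mh j i) (Pj ℓ k P j) q (one_le_Pj hP j) hq b).2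
  have hwin := D.lev_window hR ht hbmem htj (supNorm_lt_of_inCube hP hq hbcube htcube)
  by_cases hd : Down D j q
  · have hi1 := hdown hd
    obtain ⟨z₁, hz₁, hz₁c, hz₁l⟩ := hd
    rcases Nat.lt_or_ge (D.lev (emb ℓ i (MhP ℓ Mh j i) (Pj ℓ k P j) q (one_le_Pj hP j) hq b).1) (j + 1) with hlt | hge
    · omega
    · exfalso
      exact D.not_both_sides hℓ hR hz₁ hbmem (supNorm_lt_of_inCube hP hq hz₁c htcube)
        (supNorm_lt_of_inCube hP hq hbcube htcube) hz₁l (by omega)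
  · have hi1 := hup hd
    have hne : D.lev (emb ℓ i (MhP ℓ Mh j i) (Pj ℓ k P j) q (one_le_Pj hP j) hq b).1 + 1 ≠ j := fun h =>
      hd ⟨_, hbmem, hbcube, h⟩
    omega

/-- the finer level is `j − 1` or `j` (and, vacuously recorded for positional compatibility with the twin, `≥ 0`).
[cite: Balaban1984PropagatorsII, p.230] -/
theorem fin_spec {j : ℕ} {q : Fin (d + 1) → ℤ} :
    0 ≤ fin D j q ∧ fin D j q ≤ j ∧ j ≤ fin D j q + 1 ∧ (Down D j q → fin D j q + 1 = j) ∧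
      (¬ Down D j q → fin D j q = j) := by
  unfold fin
  by_cases hd : Down D j q
  · obtain ⟨z, hz, hzc, hzl⟩ := hd
    rw [if_pos (show Down D j q from ⟨z, hz, hzc, hzl⟩)]
    exact ⟨Nat.zero_le _, by omega, by omega, fun _ => by omega, fun h => absurd ⟨z, hz, hzc, hzl⟩ h⟩
  · rw [if_neg hd]
    exact ⟨Nat.zero_le _, le_rfl, by omega, fun h => absurd h hd, fun _ => rfl⟩

/-- at level `0` no cube looks down: `fin D 0 q = 0`. [cite: Balaban1984PropagatorsII, p.230, (2.3) p.224 («Λ₀ = Ω₁^c»)] -/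
theorem fin_zero (q : Fin (d + 1) → ℤ) : fin D 0 q = 0 := by
  unfold fin
  split_ifs <;> simp

end Cover

/-! ## §6 `G′₀`, `R` and (2.38) on the reference presentation of the box, levels `0 … k` -/

section Assembly

variable {ℓ Mh k R : ℕ} {P : Fin (d + 1) → ℕ} (D : Domains d ℓ Mh k P R) (a c : ℕ → ℝ)

open Classical in
/-- **THE COVER 𝒟** as a finite index set: pairs `(j, q)` of a level `0 ≤ j ≤ k` and an active cut cube of that level («Taking
these covers for all j from 0 to k we get a family 𝒟 of cubes □ of different sizes»). [cite: Balaban1984PropagatorsII, p.229] -/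
def cubeSet : Finset (ℕ × (Fin (d + 1) → ℤ)) :=
  ((Finset.Icc 0 k) ×ˢ ctrs (Pj ℓ k P 0)).filter fun cq => cq.2 ∈ ctrs (Pj ℓ k P cq.1) ∧ Active D cq.1 cq.2

variable {D}

/-- the label sets shrink with the level: `ctrs (Pj j) ⊆ ctrs (Pj 0)` for every `j`. [cite: Balaban1984PropagatorsII, p.229, dictionary] -/
theorem ctrs_Pj_subset (j : ℕ) : ctrs (Pj ℓ k P j) ⊆ ctrs (Pj ℓ k P 0) := by
  intro q hq
  rw [mem_ctrs] at hq ⊢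
  intro μ
  obtain ⟨h0, h1⟩ := hq μ
  refine ⟨h0, h1.trans ?_⟩
  unfold Pj
  exact_mod_cast Nat.mul_le_mul_right _ (Nat.pow_le_pow_right (by omega) (by omega))

/-- membership in the cover (the first conjunct `0 ≤ j` is vacuous; kept for positional compatibility with the twin).
[cite: Balaban1984PropagatorsII, p.229] -/
theorem mem_cubeSet {cq : ℕ × (Fin (d + 1) → ℤ)} :
    cq ∈ cubeSet D ↔ (0 ≤ cq.1 ∧ cq.1 ≤ k) ∧ cq.2 ∈ ctrs (Pj ℓ k P cq.1) ∧ Active D cq.1 cq.2 := by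
  classical
  unfold cubeSet
  rw [Finset.mem_filter, Finset.mem_product, Finset.mem_Icc]
  constructor
  · rintro ⟨⟨hj, -⟩, hq, ha⟩
    exact ⟨hj, hq, ha⟩
  · rintro ⟨hj, hq, ha⟩
    exact ⟨⟨hj, ctrs_Pj_subset cq.1 hq⟩, hq, ha⟩

variable (D)

/-- data of an active cube: level in `[0, k]`, label, activity (first conjunct of `hj` vacuous; positional compatibility with
the twin). [cite: Balaban1984PropagatorsII, p.229–230] -/
structure CubeData (cq : ℕ × (Fin (d + 1) → ℤ)) : Prop where
  hj : 0 ≤ cq.1 ∧ cq.1 ≤ k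
  hq : cq.2 ∈ ctrs (Pj ℓ k P cq.1)
  hact : Active D cq.1 cq.2

variable {D} in
/-- members of the cover carry `CubeData`. [cite: Balaban1984PropagatorsII, p.229] -/
theorem cubeData_of_mem {cq : ℕ × (Fin (d + 1) → ℤ)} (h : cq ∈ cubeSet D) : CubeData D cq :=
  let ⟨hj, hq, hact⟩ := mem_cubeSet.1 h
  ⟨hj, hq, hact⟩

variable {D} in
/-- the finer level of an active cube: `0 ≤ i ≤ j ≤ i + 1` and the framing conditions. [cite: Balaban1984PropagatorsII, p.230] -/
theorem fin_data {cq : ℕ × (Fin (d + 1) → ℤ)} (_hc : CubeData D cq) :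
    0 ≤ fin D cq.1 cq.2 ∧ fin D cq.1 cq.2 ≤ cq.1 ∧ cq.1 ≤ fin D cq.1 cq.2 + 1 ∧
      (Down D cq.1 cq.2 → fin D cq.1 cq.2 + 1 = cq.1) ∧ (¬ Down D cq.1 cq.2 → fin D cq.1 cq.2 = cq.1) :=
  fin_spec

/-- the RIGHT cut-off of the cube `(j, q)`: `v_□ = h_□·1_{B^j(Λ_j)}` (family with level `0`). [cite: Balaban1984PropagatorsII, (2.36)–(2.37) p.229] -/
def vFun (j : ℕ) (q z : Fin (d + 1) → ℤ) : ℝ := uFun ℓ Mh j q z * (if D.lev z = j then 1 else 0)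

/-- the RIGHT cut-off `v_□` of a member of the cover, on the reference presentation. [cite: Balaban1984PropagatorsII, (2.36)–(2.37) p.229] -/
def vX (cq : ℕ × (Fin (d + 1) → ℤ)) (z : ↥(boxDom (N0 ℓ Mh k P))) : ℝ := vFun D cq.1 cq.2 z.1

/-- **THE PADDED CUBE PROPAGATOR `G′(□)`** of a member of the cover on the reference presentation:
`resᵀ·(L^{2i}·gTwoLevel)·res` transported by the cast (`i = fin ≥ 0`). [cite: Balaban1984PropagatorsII, (2.37) p.229] -/
def gX (hP : ∀ μ, 1 ≤ P μ) (cq : ℕ × (Fin (d + 1) → ℤ)) (hc : CubeData D cq) :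
    Matrix ↥(boxDom (N0 ℓ Mh k P)) ↥(boxDom (N0 ℓ Mh k P)) ℝ :=
  Matrix.reindex (castP (fin_data hc).2.1 hc.hj.2) (castP (fin_data hc).2.1 hc.hj.2)
    ((res (emb ℓ (fin D cq.1 cq.2) (MhP ℓ Mh cq.1 (fin D cq.1 cq.2)) (Pj ℓ k P cq.1) cq.2 (one_le_Pj hP cq.1) hc.hq))ᵀ
      * (((((ℓ : ℝ) + 1)) ^ fin D cq.1 cq.2) ^ 2 • cG D a c cq.1 (fin D cq.1 cq.2) cq.2 hP hc.hq)
      * res (emb ℓ (fin D cq.1 cq.2) (MhP ℓ Mh cq.1 (fin D cq.1 cq.2)) (Pj ℓ k P cq.1) cq.2 (one_le_Pj hP cq.1) hc.hq))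

/-- **THE SUMMAND `h_□G′(□)v_□` OF (2.37)**. [cite: Balaban1984PropagatorsII, (2.37) p.229] -/
def aX (hP : ∀ μ, 1 ≤ P μ) (cq : ℕ × (Fin (d + 1) → ℤ)) (hc : CubeData D cq) :
    Matrix ↥(boxDom (N0 ℓ Mh k P)) ↥(boxDom (N0 ℓ Mh k P)) ℝ :=
  Matrix.diagonal (uX cq) * gX D a c hP cq hc * Matrix.diagonal (vX D cq)

/-- **THE SUMMAND `K(h_□)G′(□)v_□` OF `R` (2.38)**, as the padded LOCAL two-level commutator term
`resᵀ·(K_□(h_□)·gTwoLevel·v′_□)·res` transported by the cast — the object bounded by (2.44) (at its mesh `L^{−i}`, `i ≥ 0`).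
[cite: Balaban1984PropagatorsII, (2.38) p.229, (2.44) p.230] -/
def bX (hP : ∀ μ, 1 ≤ P μ) (cq : ℕ × (Fin (d + 1) → ℤ)) (hc : CubeData D cq) :
    Matrix ↥(boxDom (N0 ℓ Mh k P)) ↥(boxDom (N0 ℓ Mh k P)) ℝ :=
  Matrix.reindex (castP (fin_data hc).2.1 hc.hj.2) (castP (fin_data hc).2.1 hc.hj.2)
    ((res (emb ℓ (fin D cq.1 cq.2) (MhP ℓ Mh cq.1 (fin D cq.1 cq.2)) (Pj ℓ k P cq.1) cq.2 (one_le_Pj hP cq.1) hc.hq))ᵀ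
      * (kComm (cOp D a c cq.1 (fin D cq.1 cq.2) cq.2 hP hc.hq)
            (hLoc ℓ (fin D cq.1 cq.2) (MhP ℓ Mh cq.1 (fin D cq.1 cq.2)) (Pj ℓ k P cq.1) cq.2)
          * cG D a c cq.1 (fin D cq.1 cq.2) cq.2 hP hc.hq
          * Matrix.diagonal ((fun z => vFun D cq.1 cq.2 z.1)
              ∘ emb ℓ (fin D cq.1 cq.2) (MhP ℓ Mh cq.1 (fin D cq.1 cq.2)) (Pj ℓ k P cq.1) cq.2 (one_le_Pj hP cq.1)
                  hc.hq))
      * res (emb ℓ (fin D cq.1 cq.2) (MhP ℓ Mh cq.1 (fin D cq.1 cq.2)) (Pj ℓ k P cq.1) cq.2 (one_le_Pj hP cq.1) hc.hq))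

/-- **`G′₀ = Σ_{□∈𝒟} h_□G′(□)v_□` (2.37)** for the genuine `k`-level operator on the box, levels `0 … k`. [cite: Balaban1984PropagatorsII, (2.37) p.229] -/
def gZeroML (hP : ∀ μ, 1 ≤ P μ) : Matrix ↥(boxDom (N0 ℓ Mh k P)) ↥(boxDom (N0 ℓ Mh k P)) ℝ :=
  ∑ cq ∈ (cubeSet D).attach, aX D a c hP cq.1 (cubeData_of_mem cq.2)

/-- **`R = Σ_{□∈𝒟} K(h_□)G′(□)v_□` (2.38)** for the genuine `k`-level operator on the box, levels `0 … k`. [cite: Balaban1984PropagatorsII, (2.38) p.229] -/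
def rML (hP : ∀ μ, 1 ≤ P μ) : Matrix ↥(boxDom (N0 ℓ Mh k P)) ↥(boxDom (N0 ℓ Mh k P)) ℝ :=
  ∑ cq ∈ (cubeSet D).attach, bX D a c hP cq.1 (cubeData_of_mem cq.2)

variable {D a c}

/-- **`Δ′_a` TIMES ONE SUMMAND**: `Δ′_a·(h_□G′(□)v_□) = h_□v_□ − K(h_□)G′(□)v_□` on the reference presentation
(`mlOp_mul_term` for the active cube, with its two-level window from (2.2), transported by the cast), levels `0 … k`.
[cite: Balaban1984PropagatorsII, (2.37)–(2.38) p.229] -/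
theorem mlOp_mul_aX (hℓ : 1 ≤ ℓ) (hR : 2 * (ℓ + 1) ≤ R) (hP : ∀ μ, 1 ≤ P μ) (hMh : 2 ≤ Mh)
    (ha : ∀ i, 0 < a i) (hcpos : ∀ i, 0 < c i)
    (hac : ∀ i, a (i + 1) = aNext ℓ (a i) (c i))
    (cq : ℕ × (Fin (d + 1) → ℤ)) (hc : CubeData D cq) :
    mlOp (N0 ℓ Mh k P) ℓ k D.lev a * aX D a c hP cq hc
      = Matrix.diagonal (fun z => uX cq z * vX D cq z) - bX D a c hP cq hc := by
  obtain ⟨-, hij, hji, hdown, hup⟩ := fin_data hc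
  have hjk := hc.hj.2
  have hwin := window_of_active (D := D) hℓ hR hP hMh hij hjk hc.hq hc.hact hdown hup
  have hterm := mlOp_mul_term (D := D) (a := a) (c := c) hℓ hP hMh hc.hq hij hjk (ha _) (hcpos _)
    (hac _) hwin (fun z => vFun D cq.1 cq.2 z.1)
  have hE : mlOp (N0 ℓ Mh k P) ℓ k D.lev a
      = Matrix.reindex (castP hij hjk) (castP hij hjk) (Ep D a cq.1 (fin D cq.1 cq.2)) :=
    mlOp_eq_reindex (ℓ := ℓ) (k := k) (Np_eq (ℓ := ℓ) (Mh := Mh) (P := P) hij hjk) D.lev a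
  -- reindexing bookkeeping (multiplicative, diagonal, subtraction)
  have reindex_mul : ∀ A B : Matrix ↥(Box d ℓ (fin D cq.1 cq.2)
      (fun μ => (ℓ + 1) * (MhP ℓ Mh cq.1 (fin D cq.1 cq.2) * Pj ℓ k P cq.1 μ))) ↥(Box d ℓ (fin D cq.1 cq.2)
      (fun μ => (ℓ + 1) * (MhP ℓ Mh cq.1 (fin D cq.1 cq.2) * Pj ℓ k P cq.1 μ))) ℝ,
      Matrix.reindex (castP hij hjk) (castP hij hjk) A * Matrix.reindex (castP hij hjk) (castP hij hjk) B
        = Matrix.reindex (castP (ℓ := ℓ) (Mh := Mh) (k := k) (P := P) hij hjk) (castP hij hjk) (A * B) := fun A B => by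
    simp only [Matrix.reindex_apply, Matrix.submatrix_mul_equiv]
  have reindex_diag : ∀ f : ↥(Box d ℓ (fin D cq.1 cq.2)
      (fun μ => (ℓ + 1) * (MhP ℓ Mh cq.1 (fin D cq.1 cq.2) * Pj ℓ k P cq.1 μ))) → ℝ,
      Matrix.reindex (castP (ℓ := ℓ) (Mh := Mh) (k := k) (P := P) hij hjk) (castP hij hjk) (Matrix.diagonal f)
        = Matrix.diagonal (f ∘ (castP hij hjk).symm) := fun f => by
    rw [Matrix.reindex_apply, Matrix.submatrix_diagonal_equiv]
  -- the cut-offs as transported diagonal matrices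
  have hu : Matrix.reindex (castP hij hjk) (castP hij hjk)
        (Matrix.diagonal (hΩ ℓ (fin D cq.1 cq.2) (MhP ℓ Mh cq.1 (fin D cq.1 cq.2)) (Pj ℓ k P cq.1) cq.2))
      = Matrix.diagonal (uX (ℓ := ℓ) (Mh := Mh) (k := k) (P := P) cq) := by
    rw [reindex_diag]
    refine congrArg Matrix.diagonal (funext fun z => ?_)
    rw [Function.comp_apply, ← uFun_eq_hΩ hij cq.2]
    simp only [uX, castP, boxCast_symm_apply_val]
  have hv : Matrix.reindex (castP hij hjk) (castP hij hjk) (Matrix.diagonal (fun z => vFun D cq.1 cq.2 z.1))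
      = Matrix.diagonal (vX D cq) := by
    rw [reindex_diag]
    refine congrArg Matrix.diagonal (funext fun z => ?_)
    rw [Function.comp_apply]
    simp only [vX, castP, boxCast_symm_apply_val]
  have huv : Matrix.reindex (castP hij hjk) (castP hij hjk)
        (Matrix.diagonal (fun z => hΩ ℓ (fin D cq.1 cq.2) (MhP ℓ Mh cq.1 (fin D cq.1 cq.2)) (Pj ℓ k P cq.1) cq.2 z
          * vFun D cq.1 cq.2 z.1))
      = Matrix.diagonal (fun z => uX (ℓ := ℓ) (Mh := Mh) (k := k) (P := P) cq z * vX D cq z) := by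
    rw [reindex_diag]
    refine congrArg Matrix.diagonal (funext fun z => ?_)
    rw [Function.comp_apply, ← uFun_eq_hΩ hij cq.2]
    simp only [uX, vX, castP, boxCast_symm_apply_val]
  have hgX : gX D a c hP cq hc = Matrix.reindex (castP hij hjk) (castP hij hjk)
      ((res (emb ℓ (fin D cq.1 cq.2) (MhP ℓ Mh cq.1 (fin D cq.1 cq.2)) (Pj ℓ k P cq.1) cq.2 (one_le_Pj hP cq.1)
          hc.hq))ᵀ
        * (((((ℓ : ℝ) + 1)) ^ fin D cq.1 cq.2) ^ 2 • cG D a c cq.1 (fin D cq.1 cq.2) cq.2 hP hc.hq)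
        * res (emb ℓ (fin D cq.1 cq.2) (MhP ℓ Mh cq.1 (fin D cq.1 cq.2)) (Pj ℓ k P cq.1) cq.2 (one_le_Pj hP cq.1)
          hc.hq)) := rfl
  have hbX : bX D a c hP cq hc = Matrix.reindex (castP hij hjk) (castP hij hjk)
      ((res (emb ℓ (fin D cq.1 cq.2) (MhP ℓ Mh cq.1 (fin D cq.1 cq.2)) (Pj ℓ k P cq.1) cq.2 (one_le_Pj hP cq.1)
          hc.hq))ᵀ
        * (kComm (cOp D a c cq.1 (fin D cq.1 cq.2) cq.2 hP hc.hq)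
              (hLoc ℓ (fin D cq.1 cq.2) (MhP ℓ Mh cq.1 (fin D cq.1 cq.2)) (Pj ℓ k P cq.1) cq.2)
            * cG D a c cq.1 (fin D cq.1 cq.2) cq.2 hP hc.hq
            * Matrix.diagonal ((fun z => vFun D cq.1 cq.2 z.1)
                ∘ emb ℓ (fin D cq.1 cq.2) (MhP ℓ Mh cq.1 (fin D cq.1 cq.2)) (Pj ℓ k P cq.1) cq.2 (one_le_Pj hP cq.1)
                    hc.hq))
        * res (emb ℓ (fin D cq.1 cq.2) (MhP ℓ Mh cq.1 (fin D cq.1 cq.2)) (Pj ℓ k P cq.1) cq.2 (one_le_Pj hP cq.1)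
          hc.hq)) := rfl
  unfold aX
  rw [hgX, hbX, hE, ← hu, ← hv, reindex_mul, reindex_mul, reindex_mul, ← huv]
  have reindex_sub : ∀ A B : Matrix ↥(Box d ℓ (fin D cq.1 cq.2)
      (fun μ => (ℓ + 1) * (MhP ℓ Mh cq.1 (fin D cq.1 cq.2) * Pj ℓ k P cq.1 μ))) ↥(Box d ℓ (fin D cq.1 cq.2)
      (fun μ => (ℓ + 1) * (MhP ℓ Mh cq.1 (fin D cq.1 cq.2) * Pj ℓ k P cq.1 μ))) ℝ,
      Matrix.reindex (castP (ℓ := ℓ) (Mh := Mh) (k := k) (P := P) hij hjk) (castP hij hjk) (A - B)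
        = Matrix.reindex (castP hij hjk) (castP hij hjk) A - Matrix.reindex (castP hij hjk) (castP hij hjk) B :=
    fun A B => by simp only [Matrix.reindex_apply, Matrix.submatrix_sub]; rfl
  rw [← reindex_sub]
  exact congrArg _ hterm

/-- **(2.36) FOR THE COVER**: `Σ_{□∈𝒟} u_□(z)v_□(z) = 1` at every site — the (1.118) identity `Σ_q h_q² = 1` of the level of
`z` (`B6Partition236TwoLevelBox.sum_hq_sq`; at level `0` the profiles of scale `M`), the other levels being cut away by
`1_{B^j(Λ_j)}` and the inactive cubes of that level vanishing at `z`. [cite: Balaban1984PropagatorsII, (2.36) p.229; Balaban1984PropagatorsI, (1.118) p.36] -/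
theorem sum_uv_eq_one (hMh : 1 ≤ Mh) (z : ↥(boxDom (N0 ℓ Mh k P))) :
    ∑ cq ∈ (cubeSet D).attach, uX cq.1 z * vX D cq.1 z = 1 := by
  classical
  rw [Finset.sum_attach (cubeSet D) (fun cq => uX cq z * vX D cq z)]
  unfold cubeSet
  rw [Finset.sum_filter, Finset.sum_product]
  have hj₀mem : D.lev z.1 ∈ Finset.Icc 0 k := Finset.mem_Icc.2 ⟨Nat.zero_le _, D.lev_le _⟩
  have hN1 : 1 ≤ (ℓ + 1) ^ D.lev z.1 * ((ℓ + 1) * Mh) := Nat.one_le_iff_ne_zero.2 (by positivity)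
  have hS : ∀ μ, N0 ℓ Mh k P μ = (ℓ + 1) ^ D.lev z.1 * ((ℓ + 1) * Mh) * Pj ℓ k P (D.lev z.1) μ := by
    intro μ
    have hpow : (ℓ + 1) ^ k = (ℓ + 1) ^ D.lev z.1 * (ℓ + 1) ^ (k - D.lev z.1) := by
      rw [← pow_add, Nat.add_sub_cancel' (D.lev_le z.1)]
    simp only [N0, Pj]
    rw [hpow]
    ring
  -- every level other than `lev z` contributes zero; at `lev z` the indicator conditions are automatic
  have hrow : ∀ j ∈ Finset.Icc 0 k, ∑ q ∈ ctrs (Pj ℓ k P 0),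
      (if (j, q).2 ∈ ctrs (Pj ℓ k P (j, q).1) ∧ Active D (j, q).1 (j, q).2 then uX (j, q) z * vX D (j, q) z else 0)
        = if j = D.lev z.1 then 1 else 0 := by
    intro j _
    by_cases hjj : j = D.lev z.1
    · rw [if_pos hjj]
      subst hjj
      have hterm : ∀ q ∈ ctrs (Pj ℓ k P 0),
          (if (D.lev z.1, q).2 ∈ ctrs (Pj ℓ k P (D.lev z.1, q).1) ∧ Active D (D.lev z.1, q).1 (D.lev z.1, q).2
            then uX (D.lev z.1, q) z * vX D (D.lev z.1, q) z else 0) = uFun ℓ Mh (D.lev z.1) q z.1 ^ 2 := by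
        intro q _
        dsimp only
        by_cases hu : uFun ℓ Mh (D.lev z.1) q z.1 = 0
        · simp [uX, vX, vFun, hu]
        · have hqj : q ∈ ctrs (Pj ℓ k P (D.lev z.1)) := mem_ctrs_of_hq_ne_zero hN1 hS z.2 hu
          have hact : Active D (D.lev z.1) q := ⟨z.1, z.2, rfl, hu⟩
          rw [if_pos ⟨hqj, hact⟩]
          simp only [uX, vX, vFun, if_true, mul_one]
          ring
      rw [Finset.sum_congr rfl hterm, ← Finset.sum_subset (ctrs_Pj_subset (k := k) (P := P) (D.lev z.1))
        (fun q _ hq => by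
          have h0 : uFun ℓ Mh (D.lev z.1) q z.1 = 0 := by
            by_contra h
            exact hq (mem_ctrs_of_hq_ne_zero hN1 hS z.2 h)
          rw [h0]; ring)]
      exact sum_hq_sq hN1 hS z.2
    · rw [if_neg hjj]
      refine Finset.sum_eq_zero fun q _ => ?_
      dsimp only
      have hne : ¬ D.lev z.1 = j := fun h => hjj h.symm
      simp [uX, vX, vFun, hne]
  rw [Finset.sum_congr rfl hrow]
  simp [hj₀mem]

/-- **[B6] (2.38) FOR THE GENUINE `k`-LEVEL OPERATOR ON A BOX, LEVEL `0` ADMITTED**: `Δ′_a·G′₀ = 1 − R` with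
`G′₀ = Σ_{□∈𝒟} h_□G′(□)v_□` over the multi-size cover of ALL levels `0 … k` (genuine two-level cube propagators at every
level, the mesh-one member at level `0`) and `R = Σ_{□∈𝒟} K(h_□)G′(□)v_□`, each term of `R` the padded LOCAL commutator term of
its cube — for every nested family (2.1)–(2.2) with `R ≥ 2L` (`Λ₀ = X ∖ Ω₁` possibly non-empty), every `k`, `L ≥ 2`,
`M_h ≥ 2`, every box, and all positive weights with `a_{i+1} = aNext ℓ a_i c_i` (`i ≥ 0`).
[cite: Balaban1984PropagatorsII, (2.36)–(2.38) p.229] -/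
theorem eq238_multiLevelBox (hℓ : 1 ≤ ℓ) (hR : 2 * (ℓ + 1) ≤ R) (hP : ∀ μ, 1 ≤ P μ) (hMh : 2 ≤ Mh)
    (ha : ∀ i, 0 < a i) (hcpos : ∀ i, 0 < c i)
    (hac : ∀ i, a (i + 1) = aNext ℓ (a i) (c i)) :
    mlOp (N0 ℓ Mh k P) ℓ k D.lev a * gZeroML D a c hP = 1 - rML D a c hP := by
  have hMh1 : 1 ≤ Mh := le_trans (by norm_num) hMh
  -- a finite sum of diagonal matrices is the diagonal matrix of the sum
  have sum_diagonal : ∀ (s : Finset {cq // cq ∈ cubeSet D})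
      (f : {cq // cq ∈ cubeSet D} → ↥(boxDom (N0 ℓ Mh k P)) → ℝ),
      ∑ i ∈ s, Matrix.diagonal (f i) = Matrix.diagonal (fun x => ∑ i ∈ s, f i x) := by
    intro s f
    classical
    induction s using Finset.induction_on with
    | empty => simp
    | insert a s ha ih =>
        rw [Finset.sum_insert ha, ih, Matrix.diagonal_add]
        congr 1
        funext x
        rw [Finset.sum_insert ha]
  unfold gZeroML rML
  rw [Finset.mul_sum]
  rw [Finset.sum_congr rfl fun cq _ => mlOp_mul_aX hℓ hR hP hMh ha hcpos hac cq.1 (cubeData_of_mem cq.2),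
    Finset.sum_sub_distrib, sum_diagonal]
  congr 1
  have : (fun x : ↥(boxDom (N0 ℓ Mh k P)) => ∑ cq ∈ (cubeSet D).attach,
      uX cq.1 x * vX D cq.1 x) = fun _ => 1 := funext fun z => sum_uv_eq_one (D := D) hMh1 z
  rw [this]
  exact Matrix.diagonal_one

/-- on an embedded family of the twin structure (`Λ₀ = ∅`) the level-`0` cubes are all inactive, and the cover, `G′₀` and `R`
have the same summands as the twin's — recorded here only through the operator identity (2.38), which holds for both.
[cite: Balaban1984PropagatorsII, (2.38) p.229] -/
theorem not_active_zero_ofBox (D₁ : B6MultiLevelBoxOperator.Domains d ℓ Mh k P R) (q : Fin (d + 1) → ℤ) :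
    ¬ Active (Domains.ofBox D₁) 0 q := by
  rintro ⟨z, -, hz0, -⟩
  have h1 := D₁.one_le_lev z
  have h0 : D₁.lev z = 0 := hz0
  omega

end Assembly

end

end Literature.MathematicalPhysics.QuantumFieldTheory.Balaban1983to89.B6Eq238MultiLevelBoxL0
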